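/-
Copyright (c) 2026. Released under Apache 2.0 license.
-/
import Literature.NumberTheory.Automorphic.UnboundedDenominatorsInvariantHomGluing
import Literature.NumberTheory.Automorphic.UnboundedDenominatorsInvariantHomCyclic
import Literature.NumberTheory.EllipticCurves.ModularCurveGammaIndex
import Literature.NumberTheory.Automorphic.UnboundedDenominatorsInvariantHomGamma1
import HarnessLib

/-!
# The invariant form of CDT Cor. 4.5.3: local certificates at a coprime factor of the level

Relative versions (level `N = m' · m`, `gcd(m', m) = 1`; the factor `Γ(m')/Γ(N) ≅ SL₂(ℤ/m)`) of the local lemmas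
feeding the gluing `UnboundedDenominatorsInvariantHomGluing.local_Gamma_of_local_Gamma_mul`:

* `local_Gamma_self` — the local condition for `Γ(N)` itself is automatic;
* `local_Gamma_of_zpowers` — **cyclic certificate**: if `SL₂(ℤ/m)` has an element `c̄` with `[SL₂(ℤ/m) : ⟨c̄⟩]`
  prime to an exponent `e` of `θ`, then `θ` satisfies the local condition for `Γ(m')` (lift `c̄` inside `Γ(m')`
  by strong approximation; `H = ⟨c⟩·Γ(N)` has `[H, H] ≤ K_θ`; relative transfer);
* `exists_zpowers_map_T_index_eq` — the unipotent `T̄ ∈ SL₂(𝔽_p)` has `[SL₂(𝔽_p) : ⟨T̄⟩] = (p+1)(p-1)`;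
* `local_Gamma_of_local_Gamma_mul'` — the gluing lemma with the level as a variable.

[cite: CalegariDimitrovTang2025, Corollary 4.5.3]
-/

open scoped MatrixGroups commutatorElement

namespace Literature.NumberTheory.Automorphic

namespace UnboundedDenominators

open CongruenceSubgroup Matrix.SpecialLinearGroup ModularGroup
open Literature.GroupTheory.ArithmeticGroups.IharaAmalgam (exists_mem_Gamma_forall_dvd_sub)
open Literature.NumberTheory.EllipticCurves.ModularForms (specialLinearGroup_map_surjective
  index_Gamma_eq_card index_Gamma_eq_mul)

variable {Q : Type*} [CommGroup Q]

/-- `Γ(L) ≤ Γ(M)` for `M ∣ L`. [folklore] -/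
private theorem Gamma_le_Gamma_of_dvd₃ {M L : ℕ} (h : M ∣ L) : Gamma L ≤ Gamma M := by
  intro γ hγ
  obtain ⟨h00, h01, h10, h11⟩ := Gamma_mem.mp hγ
  have cast_eq : ∀ a : ℤ, ((a : ZMod L).cast : ZMod M) = (a : ZMod M) := fun a ↦
    ZMod.cast_intCast h a
  rw [Gamma_mem]
  refine ⟨?_, ?_, ?_, ?_⟩
  · rw [← cast_eq, h00, ZMod.cast_one h]
  · rw [← cast_eq, h01, ZMod.cast_zero]
  · rw [← cast_eq, h10, ZMod.cast_zero]
  · rw [← cast_eq, h11, ZMod.cast_one h]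

/-- **The local condition for `Γ(N)` itself** holds for every invariant `θ` (`θ` kills `[Γ(N), Γ(N)]`).
[cite: CalegariDimitrovTang2025, Corollary 4.5.3] -/
theorem local_Gamma_self {N : ℕ} (θ : Gamma N →* Q)
    (hθ : ∀ (g x : SL(2, ℤ)) (hx : x ∈ Gamma N) (hgx : g * x * g⁻¹ ∈ Gamma N),
      θ ⟨g * x * g⁻¹, hgx⟩ = θ ⟨x, hx⟩) :
    ∀ (y : SL(2, ℤ)) (hy : y ∈ Gamma N), y ∈ ⁅Gamma N, Gamma N⁆ ⊔ θ.ker.map (Gamma N).subtype →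
      θ ⟨y, hy⟩ = 1 := by
  haveI := ker_map_subtype_normal θ hθ
  intro y hy hyc
  rw [Subgroup.mem_sup_of_normal_right] at hyc
  obtain ⟨u, hu, v, hv, rfl⟩ := hyc
  have hu' : u ∈ ⁅(⊤ : Subgroup SL(2, ℤ)), Gamma N⁆ := Subgroup.commutator_mono le_top le_rfl hu
  obtain ⟨hvN, hv1⟩ := (mem_ker_map_subtype_iff θ).mp hv
  have huN : u ∈ Gamma N := by simpa using mul_mem hy (inv_mem hvN)
  have heq : (⟨u * v, hy⟩ : Gamma N) = ⟨u, huN⟩ * ⟨v, hvN⟩ := rfl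
  rw [heq, map_mul, map_eq_one_of_mem_commutator θ hθ hu' huN, hv1, one_mul]

/-- A lift of `c̄ ∈ SL₂(ℤ/m)` inside `Γ(m')` (`gcd(m', m) = 1`, strong approximation). [cite: ShimuraIATAF1971, Lemma 1.38] -/
theorem exists_mem_Gamma_map_eq {m m' : ℕ} [NeZero m] (hmm : m'.Coprime m) (cbar : SL(2, ZMod m)) :
    ∃ c ∈ Gamma m', Matrix.SpecialLinearGroup.map (Int.castRingHom (ZMod m)) c = cbar := by
  obtain ⟨c₀, hc₀⟩ := specialLinearGroup_map_surjective m cbar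
  obtain ⟨γ, hγ, h⟩ := exists_mem_Gamma_forall_dvd_sub hmm c₀
  refine ⟨γ, hγ, ?_⟩
  have h1 : γ⁻¹ * c₀ ∈ Gamma m := inv_mul_mem_Gamma_of_forall_dvd_sub h
  rw [Gamma_mem', map_mul, map_inv, inv_mul_eq_one] at h1
  rw [h1, hc₀]

/-- **Cyclic certificate at a coprime factor.**  Let `N = m'·m` with `gcd(m', m) = 1`, let `θ : Γ(N) → Q` be
`SL₂(ℤ)`-invariant with `θ(x)^e = 1`, and let `c̄ ∈ SL₂(ℤ/m)` have `[SL₂(ℤ/m) : ⟨c̄⟩]` prime to `e`.  Then `θ` kills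
`Γ(N) ∩ ([Γ(m'), Γ(m')]·K_θ)` (the local condition at the factor `Γ(m')/Γ(N) ≅ SL₂(ℤ/m)`).
[cite: CalegariDimitrovTang2025, Corollary 4.5.3] -/
theorem local_Gamma_of_zpowers {m m' : ℕ} [NeZero m] [NeZero m'] (hmm : m'.Coprime m)
    (θ : Gamma (m' * m) →* Q)
    (hθ : ∀ (g x : SL(2, ℤ)) (hx : x ∈ Gamma (m' * m)) (hgx : g * x * g⁻¹ ∈ Gamma (m' * m)),
      θ ⟨g * x * g⁻¹, hgx⟩ = θ ⟨x, hx⟩)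
    {e : ℕ} (he : ∀ x : Gamma (m' * m), θ x ^ e = 1)
    (cbar : SL(2, ZMod m)) (hcop : e.Coprime (Subgroup.zpowers cbar).index) :
    ∀ (y : SL(2, ℤ)) (hy : y ∈ Gamma (m' * m)),
      y ∈ ⁅Gamma m', Gamma m'⁆ ⊔ θ.ker.map (Gamma (m' * m)).subtype → θ ⟨y, hy⟩ = 1 := by
  classical
  haveI := ker_map_subtype_normal θ hθ
  set red := Matrix.SpecialLinearGroup.map (n := Fin 2) (Int.castRingHom (ZMod m)) with hred
  obtain ⟨c, hcm', hc⟩ := exists_mem_Gamma_map_eq hmm cbar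
  set X : Subgroup SL(2, ℤ) := (Subgroup.zpowers cbar).comap red with hX
  set H : Subgroup SL(2, ℤ) := X ⊓ Gamma m' with hH
  have hNH : Gamma (m' * m) ≤ H := by
    intro x hx
    refine Subgroup.mem_inf.mpr ⟨?_, Gamma_le_Gamma_of_dvd₃ (dvd_mul_right m' m) hx⟩
    rw [hX, Subgroup.mem_comap, (Gamma_mem'.mp (Gamma_le_Gamma_of_dvd₃ (dvd_mul_left m m') hx) :
      red x = 1)]
    exact one_mem _
  -- `H = ⟨c⟩ · Γ(N)`
  have hgen : ∀ y ∈ H, ∃ (i : ℤ) (γ : SL(2, ℤ)), γ ∈ Gamma (m' * m) ∧ y = c ^ i * γ := by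
    intro y hy
    obtain ⟨hyX, hym'⟩ := Subgroup.mem_inf.mp hy
    rw [hX, Subgroup.mem_comap, Subgroup.mem_zpowers_iff] at hyX
    obtain ⟨i, hi⟩ := hyX
    refine ⟨i, c ^ (-i) * y, ?_, by group⟩
    refine mem_Gamma_mul_of_coprime hmm ?_ ?_
    · exact mul_mem (zpow_mem hcm' (-i)) hym'
    · rw [Gamma_mem', map_mul, map_zpow, ← hred, hc, ← hi, ← zpow_add, neg_add_cancel, zpow_zero]
  have hloc : ∀ (y : SL(2, ℤ)) (hy : y ∈ Gamma (m' * m)),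
      y ∈ ⁅H, H⁆ ⊔ θ.ker.map (Gamma (m' * m)).subtype → θ ⟨y, hy⟩ = 1 := by
    intro y hy hyc
    rw [sup_eq_right.mpr (commutator_le_ker_of_forall_eq_zpow_mul θ hθ H c hgen)] at hyc
    obtain ⟨_, h1⟩ := (mem_ker_map_subtype_iff θ).mp hyc
    exact h1
  -- the relative index `[Γ(m') : H] = [SL₂(ℤ/m) : ⟨c̄⟩]`
  have htop : (Gamma m').map red = ⊤ := by
    rw [eq_top_iff]
    intro s _
    obtain ⟨d, hd, hds⟩ := exists_mem_Gamma_map_eq hmm s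
    exact ⟨d, hd, hds⟩
  have hidx : H.relIndex (Gamma m') = (Subgroup.zpowers cbar).index := by
    rw [hH, Subgroup.inf_relIndex_right, hX, Subgroup.relIndex_comap, htop, Subgroup.relIndex_top_right]
  have hidx0 : H.relIndex (Gamma m') ≠ 0 := by rw [hidx]; exact Subgroup.FiniteIndex.index_ne_zero
  exact local_of_local_of_relIndex_coprime θ hθ H (Gamma m') hNH inf_le_right he hidx0 (hidx ▸ hcop) hloc

/-- **The unipotent certificate**: `[SL₂(𝔽_p) : ⟨T̄⟩] = (p + 1)(p - 1)` for a prime `p`.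
[cite: DiamondShurman2005, §1.2 and Exercise 1.2.3] -/
theorem exists_zpowers_index_eq_succ_mul_pred {p : ℕ} (hp : p.Prime) :
    ∃ cbar : SL(2, ZMod p), (Subgroup.zpowers cbar).index = (p + 1) * (p - 1) := by
  haveI : Fact p.Prime := ⟨hp⟩
  haveI : NeZero p := ⟨hp.ne_zero⟩
  set tbar : SL(2, ZMod p) := Matrix.SpecialLinearGroup.map (Int.castRingHom (ZMod p)) T with ht
  refine ⟨tbar, ?_⟩
  have hord : orderOf tbar = p := by
    refine orderOf_eq_prime ?_ ?_
    · rw [ht, ← map_pow]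
      have : (T : SL(2, ℤ)) ^ (p : ℤ) ∈ Gamma p := by
        simpa using ModularGroup_T_pow_mem_Gamma (p : ℤ) (p : ℤ) (dvd_refl _)
      rw [zpow_natCast] at this
      exact Gamma_mem'.mp this
    · intro h
      have h01 := congrArg (fun A : SL(2, ZMod p) ↦ A 0 1) h
      simp [ht, coe_T] at h01
  have hcard : Nat.card SL(2, ZMod p) = p * ((p + 1) * (p - 1)) := by
    rw [← index_Gamma_eq_card, index_Gamma_eq_mul, index_Gamma1_prime hp]
  have h := (Subgroup.zpowers tbar).index_mul_card
  rw [Nat.card_zpowers, hord, hcard, mul_comm p] at h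
  exact Nat.eq_of_mul_eq_mul_right hp.pos h

/-- The gluing lemma `local_Gamma_of_local_Gamma_mul` with the level as a variable.
[cite: CalegariDimitrovTang2025, Corollary 4.5.3] -/
theorem local_Gamma_of_local_Gamma_mul' {N B A₁ A₂ : ℕ} (hN : N = B * A₁ * A₂) (hcop : (B * A₁).Coprime A₂)
    (θ : Gamma N →* Q)
    (hθ : ∀ (g x : SL(2, ℤ)) (hx : x ∈ Gamma N) (hgx : g * x * g⁻¹ ∈ Gamma N),
      θ ⟨g * x * g⁻¹, hgx⟩ = θ ⟨x, hx⟩)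
    (loc₁ : ∀ (y : SL(2, ℤ)) (hy : y ∈ Gamma N),
      y ∈ ⁅Gamma (B * A₁), Gamma (B * A₁)⁆ ⊔ θ.ker.map (Gamma N).subtype → θ ⟨y, hy⟩ = 1)
    (loc₂ : ∀ (y : SL(2, ℤ)) (hy : y ∈ Gamma N),
      y ∈ ⁅Gamma (B * A₂), Gamma (B * A₂)⁆ ⊔ θ.ker.map (Gamma N).subtype → θ ⟨y, hy⟩ = 1) :
    ∀ (y : SL(2, ℤ)) (hy : y ∈ Gamma N), y ∈ ⁅Gamma B, Gamma B⁆ ⊔ θ.ker.map (Gamma N).subtype →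
      θ ⟨y, hy⟩ = 1 := by
  subst hN
  exact local_Gamma_of_local_Gamma_mul hcop θ hθ loc₁ loc₂

end UnboundedDenominators

end Literature.NumberTheory.Automorphic
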